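import Mathlib
import HarnessLib

/-!
# Archimedean bounds for elements with bounded denominators and for unit-norm matrices

Topic `Literature/NumberTheory/NumberFields`; namespace `Literature.NumberTheory.NumberFields`.
Theorems only, Mathlib only.  Let `K` be a number field, `|·|_w` its archimedean absolute values
(`NumberField.InfinitePlace`), `‖·‖` the sup norm of `K_∞ = mixedSpace K` over the places.  Two
elementary consequences of the archimedean product formula `∏_w |x|_w^{m_w} = |N_{K/ℚ}(x)|`
(Mathlib `NumberField.InfinitePlace.prod_eq_abs_norm`) used in reduction theory (the Siegel
property, [Borel1969, §4, §15]):

* `exists_norm_mixedEmbedding_ge_of_mul_mem` — for `b ∈ 𝓞_K ∖ 0` there is `η > 0` such that every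
  `y ≠ 0` with `b y ∈ 𝓞_K` has `‖y‖ ≥ η` (a non-zero element of the lattice `b⁻¹ 𝓞_K` is not small at
  every place: `|N(b y)| ≥ 1`);
* `exists_place_inv_apply_le` — there are `C, k` (depending on `n, K`) such that an `n × n` matrix
  `g` over `K` with `|g_ij|_w ≤ x` (`x ≥ 1`) at all places and `|N(det g)| = 1` has
  `|(g⁻¹)_ij|_w ≤ C x^k`: `g⁻¹ = adj(g) / det g`, `|adj(g)_ij|_w ≤ n! x^n` (`Matrix.det_le`) and
  `|det g|_w ≥ (n! x^n)^{-2N}` by the product formula (`N` the number of places);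
* `place_le_norm_mixedEmbedding`, `norm_mixedEmbedding_le_of_forall_le`, `mult_le_two` — bookkeeping.

## References

* A. Borel, *Introduction aux groupes arithmétiques*, Hermann (1969), §4, §15 [Borel1969].
  The statements themselves are folklore.
-/

namespace Literature.NumberTheory.NumberFields

open NumberField NumberField.mixedEmbedding NumberField.InfinitePlace
open scoped Classical

variable {K : Type*} [Field K]

/-- `m_w ≤ 2` for the multiplicity of an infinite place. [folklore] -/
theorem mult_le_two (w : InfinitePlace K) : mult w ≤ 2 := by
  rw [mult]
  split_ifs <;> norm_num

variable [NumberField K]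

/-- `|y|_w ≤ ‖y‖_{K_∞}` (the sup norm over the places). [folklore] -/
theorem place_le_norm_mixedEmbedding (y : K) (w : InfinitePlace K) :
    w y ≤ ‖mixedEmbedding K y‖ := by
  rw [norm_eq_sup'_normAtPlace, ← normAtPlace_apply w y]
  exact Finset.le_sup' (fun w => normAtPlace w (mixedEmbedding K y)) (Finset.mem_univ w)

/-- `‖y‖_{K_∞} ≤ R` as soon as `|y|_w ≤ R` at every place. [folklore] -/
theorem norm_mixedEmbedding_le_of_forall_le (y : K) {R : ℝ} (h : ∀ w : InfinitePlace K, w y ≤ R) :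
    ‖mixedEmbedding K y‖ ≤ R := by
  rw [norm_eq_sup'_normAtPlace]
  exact Finset.sup'_le _ _ fun w _ => by rw [normAtPlace_apply]; exact h w

/-- **A non-zero element of `b⁻¹ 𝓞_K` is not small at every place**: for `b ∈ 𝓞_K ∖ 0` there is
`η > 0` with `‖y‖_{K_∞} ≥ η` whenever `y ≠ 0` and `b y ∈ 𝓞_K` (`|N(b y)| ≥ 1` and the product
formula `∏_w |y|_w^{m_w} = |N(y)|`). [folklore] -/
theorem exists_norm_mixedEmbedding_ge_of_mul_mem {b : 𝓞 K} (hb : b ≠ 0) :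
    ∃ η : ℝ, 0 < η ∧ ∀ y : K, y ≠ 0 →
      (∃ r : 𝓞 K, algebraMap (𝓞 K) K r = algebraMap (𝓞 K) K b * y) → η ≤ ‖mixedEmbedding K y‖ := by
  have hb' : (algebraMap (𝓞 K) K b) ≠ 0 :=
    (map_ne_zero_iff _ (IsFractionRing.injective (𝓞 K) K)).mpr hb
  set Nb : ℝ := |((Algebra.norm ℚ (algebraMap (𝓞 K) K b) : ℚ) : ℝ)| with hNb
  have hNb0 : 0 < Nb := by
    rw [hNb, abs_pos, Rat.cast_ne_zero]
    exact Algebra.norm_ne_zero_iff.mpr hb'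
  refine ⟨min 1 Nb⁻¹, lt_min one_pos (inv_pos.2 hNb0), fun y hy ⟨r, hr⟩ => ?_⟩
  have hr0 : r ≠ 0 := by
    rintro rfl
    rw [map_zero] at hr
    exact mul_ne_zero hb' hy hr.symm
  have hNr : (1 : ℝ) ≤ |((Algebra.norm ℚ (algebraMap (𝓞 K) K r) : ℚ) : ℝ)| := by
    rw [← RingOfIntegers.coe_eq_algebraMap, ← Algebra.coe_norm_int, Rat.cast_intCast, ← Int.cast_abs]
    exact_mod_cast Int.one_le_abs (Algebra.norm_ne_zero_iff.mpr hr0)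
  have hmul : |((Algebra.norm ℚ (algebraMap (𝓞 K) K r) : ℚ) : ℝ)| =
      Nb * |((Algebra.norm ℚ y : ℚ) : ℝ)| := by
    rw [hr, map_mul, Rat.cast_mul, abs_mul]
  by_contra hlt
  rw [not_le] at hlt
  set μ : ℝ := ‖mixedEmbedding K y‖ with hμ
  have hμ0 : 0 ≤ μ := norm_nonneg _
  have hμ1 : μ < 1 := hlt.trans_le (min_le_left _ _)
  have hμN : μ < Nb⁻¹ := hlt.trans_le (min_le_right _ _)
  have hle : |((Algebra.norm ℚ y : ℚ) : ℝ)| ≤ μ := by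
    rw [← Rat.cast_abs, ← prod_eq_abs_norm]
    calc ∏ w : InfinitePlace K, w y ^ mult w ≤ ∏ w : InfinitePlace K, μ ^ mult w :=
          Finset.prod_le_prod (fun w _ => pow_nonneg (apply_nonneg w y) _)
            fun w _ => pow_le_pow_left₀ (apply_nonneg w y) (place_le_norm_mixedEmbedding y w) _
      _ = μ ^ Module.finrank ℚ K := by rw [Finset.prod_pow_eq_pow_sum, sum_mult_eq]
      _ ≤ μ := pow_le_of_le_one hμ0 hμ1.le Module.finrank_pos.ne'
  have hlt1 : Nb * |((Algebra.norm ℚ y : ℚ) : ℝ)| < 1 := by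
    calc Nb * |((Algebra.norm ℚ y : ℚ) : ℝ)| ≤ Nb * μ := mul_le_mul_of_nonneg_left hle hNb0.le
      _ < Nb * Nb⁻¹ := mul_lt_mul_of_pos_left hμN hNb0
      _ = 1 := mul_inv_cancel₀ hNb0.ne'
  linarith [hNr, hmul]

/-- **Inverses of matrices with unit-norm determinant**: there are `C ≥ 1` and `k` (depending on
`n, K`) such that an `n × n` matrix `g` over `K` with `|g_ij|_w ≤ x` (`x ≥ 1`) at every place and
`|N_{K/ℚ}(det g)| = 1` has `|(g⁻¹)_ij|_w ≤ C x^k` at every place: `g⁻¹ = adj(g) / det g`,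
`|adj(g)_ij|_w ≤ n! x^n` (`Matrix.det_le`), and `|det g|_w ≥ (n! x^n)^{-2N}` by the product formula
(`N` the number of places). [folklore] -/
theorem exists_place_inv_apply_le (n : ℕ) (K : Type*) [Field K] [NumberField K] :
    ∃ (C : ℝ) (k : ℕ), 1 ≤ C ∧ ∀ (g : Matrix (Fin n) (Fin n) K) (x : ℝ), 1 ≤ x →
      (∀ (w : InfinitePlace K) (i j : Fin n), w (g i j) ≤ x) → |Algebra.norm ℚ g.det| = 1 →
      ∀ (w : InfinitePlace K) (i j : Fin n), w (g⁻¹ i j) ≤ C * x ^ k := by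
  set N : ℕ := Fintype.card (InfinitePlace K) with hN
  have hfac : (1 : ℝ) ≤ (n.factorial : ℝ) := by exact_mod_cast Nat.succ_le_of_lt (Nat.factorial_pos n)
  refine ⟨(n.factorial : ℝ) ^ (2 * N + 1), n * (2 * N + 1), one_le_pow₀ hfac,
    fun g x hx hg hdet w i j => ?_⟩
  set d : K := g.det with hd
  set X : ℝ := (n.factorial : ℝ) * x ^ n with hX
  have hX1 : 1 ≤ X := one_le_mul_of_one_le_of_one_le hfac (one_le_pow₀ hx)
  have hX0 : 0 ≤ X := zero_le_one.trans hX1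
  -- determinants of matrices with entries `≤ x` are `≤ X` at every place
  have hdetle : ∀ (w' : InfinitePlace K) (A : Matrix (Fin n) (Fin n) K),
      (∀ i j, w' (A i j) ≤ x) → w' A.det ≤ X := fun w' A hA => by
    have h := Matrix.det_le (abv := w'.1) hA
    rw [Fintype.card_fin, nsmul_eq_mul] at h
    exact h
  have hd0 : d ≠ 0 := fun h0 => by
    rw [h0, Algebra.norm_eq_zero_iff.mpr rfl, abs_zero] at hdet
    exact zero_ne_one hdet
  have hwpos : 0 < w d := pos_iff.mpr hd0
  -- the product formula: `∏ |d|_w'^{m_w'} = 1`, all factors `≤ X²`, hence `|d|_w ≥ X^{-2N}`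
  have hprod : ∏ w' : InfinitePlace K, w' d ^ mult w' = 1 := by
    rw [prod_eq_abs_norm, hdet, Rat.cast_one]
  have hf_le : ∀ w' : InfinitePlace K, w' d ^ mult w' ≤ X ^ 2 := fun w' =>
    (pow_le_pow_left₀ (apply_nonneg _ _) (hdetle w' g (hg w')) _).trans
      (pow_le_pow_right₀ hX1 (mult_le_two w'))
  have hkey : 1 ≤ w d ^ mult w * (X ^ 2) ^ N := by
    have h1 := Finset.mul_prod_erase Finset.univ (fun w' : InfinitePlace K => w' d ^ mult w')
      (Finset.mem_univ w)
    have h2 : ∏ w' ∈ Finset.univ.erase w, w' d ^ mult w' ≤ (X ^ 2) ^ N := by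
      calc ∏ w' ∈ Finset.univ.erase w, w' d ^ mult w' ≤ ∏ _w' ∈ Finset.univ.erase w, X ^ 2 :=
            Finset.prod_le_prod (fun w' _ => pow_nonneg (apply_nonneg _ _) _) fun w' _ => hf_le w'
        _ = (X ^ 2) ^ (Finset.univ.erase w).card := Finset.prod_const _
        _ ≤ (X ^ 2) ^ N := pow_le_pow_right₀ (one_le_pow₀ hX1)
            (by rw [hN, ← Finset.card_univ]; exact Finset.card_erase_le)
    calc (1 : ℝ) = w d ^ mult w * ∏ w' ∈ Finset.univ.erase w, w' d ^ mult w' := by rw [h1, hprod]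
      _ ≤ w d ^ mult w * (X ^ 2) ^ N := mul_le_mul_of_nonneg_left h2 (pow_nonneg (apply_nonneg _ _) _)
  have hkey' : 1 ≤ w d * (X ^ 2) ^ N := by
    by_cases h1 : 1 ≤ w d
    · exact one_le_mul_of_one_le_of_one_le h1 (one_le_pow₀ (one_le_pow₀ hX1))
    · rw [not_le] at h1
      have h2 : w d ^ mult w ≤ w d := pow_le_of_le_one (apply_nonneg _ _) h1.le mult_ne_zero
      exact hkey.trans (mul_le_mul_of_nonneg_right h2 (pow_nonneg (pow_nonneg hX0 _) _))
  -- the adjugate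
  have hadj : w (g.adjugate i j) ≤ X := by
    rw [Matrix.adjugate_apply]
    refine hdetle w _ fun i' j' => ?_
    rw [Matrix.updateRow_apply]
    split_ifs with h
    · by_cases hij : j' = i
      · subst hij
        rw [Pi.single_eq_same, map_one]
        exact hx
      · rw [Pi.single_eq_of_ne hij, map_zero]
        exact zero_le_one.trans hx
    · exact hg w i' j'
  have hinv : g⁻¹ i j = d⁻¹ * g.adjugate i j := by
    rw [Matrix.inv_def, Ring.inverse_eq_inv, Matrix.smul_apply, smul_eq_mul]
  rw [hinv, map_mul, map_inv₀]
  calc (w d)⁻¹ * w (g.adjugate i j) ≤ (X ^ 2) ^ N * X := by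
        rw [inv_mul_le_iff₀ hwpos]
        calc w (g.adjugate i j) ≤ X := hadj
          _ = 1 * X := (one_mul X).symm
          _ ≤ (w d * (X ^ 2) ^ N) * X := mul_le_mul_of_nonneg_right hkey' hX0
          _ = w d * ((X ^ 2) ^ N * X) := by ring
    _ = (n.factorial : ℝ) ^ (2 * N + 1) * x ^ (n * (2 * N + 1)) := by
        rw [hX]
        ring

end Literature.NumberTheory.NumberFields
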